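import Literature.AlgebraicGeometry.Frobenioids.AffineIntegerBaseFSMType
import Literature.AnabelianGeometry.EtaleTheta.TemperedFrobenioidToyDilation
import Literature.AnabelianGeometry.EtaleTheta.TemperedFrobenioidCor38Sub
import HarnessLib

/-!
# [EtTh] Def. 3.6 (ii) AS TYPED over the ADMISSIBLE affine base `SingleObj Aff⁺(ℤ)`: the dilating tempered Frobenioid
# with unit partner `ℤ ⊆ B₀^Λ` (data brick 2a of the admissible degree↔dilation swap)

S. Mochizuki, *The étale theta function …*, Publ. RIMS **45** (2009), Def. 3.3 (iii) p. 73, Def. 3.6 (i)/(ii) pp. 76–77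
[cite: MochizukiEtTh2009, Def 3.6 p.77]; S. Mochizuki, *The geometry of Frobenioids I* (2008), Ex. 3.9 p. 72 (the base
`U ⋊ N` acting on the divisor monoid through `N`, trivially through `U`) [cite: MochizukiFrdI2008, Ex. 3.9 p.72].

abc-iut cell, block F, seat abc-iut-f-133 (gen 2).  DATA file (no instances, no notation), the sibling of abc-iut-f-142's
`TemperedFrobenioidToyDilation.lean` (`DilSwap.C` over the NON-FSMFF base `SingleObj ℕ_{≥1}`) over the FSMFF, non-groupoid
base `IntAffine.D = SingleObj Aff⁺(ℤ)` (`AffineIntegerBaseFSMType.lean`): `Φ₀ = Φ₀^ℝ = ℚ_{≥0}` on which `(n, u) ∈ Aff⁺(ℤ)`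
pulls back by the CONTRACTION `z ↦ z/n` (the translation `u` acting trivially), `B₀ = B₀^Λ = ℤ × (ℚ_{≥0})^gp` with
`Div =` second projection (the factor `ℤ` = genuine units `O^×`, on which the base acts trivially — the Frobenioid-side
partner of the base translations under the swap), `F₀ = F₀^Λ = B₀`, `ℝ·Φ₀^cnst =` everything, `Λ = ℚ`; and the typed tempered
Frobenioid `AffDil.C` (`Φ = Φ^{ℝ-log}`, group-saturated trivially, `Φ^{bs-fld} = ℚ_{≥0}` `ℚ`-monoprime — REAL clauses;
vocabulary clauses `True`).  Purpose (this seat's STATUS 2026-08-26 15:02Z): the record `Cor38Hyp C C` carrying the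
degree↔dilation swap `σ(d, (n,u), z, (k,ξ)) = (n, (d,k), (n/d)·z, (u,ξ'))` — a self-equivalence moving the LINEAR base
dilation `(1, (2,0), 0)` to Frobenius degree `2` — exists over THIS base because `IntAffine.isOfFSMFFType_D` holds; the swap
and the resulting refutation of the bare universal closure of `Cor38Hyp.PreservesLinear` (F-2815) are the sequel (brick 2b).
HONEST FRAMING: a toy inhabitant of the typed Def. 3.6 interface (dilating `Φ`, allowed only because "non-dilating" is a free
vocabulary clause); nothing here bears on [IUTchIII] Cor. 3.12; no side taken; typed ≠ proved.
-/

noncomputable section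

namespace Literature.AnabelianGeometry.EtaleTheta

open CategoryTheory Opposite Literature.AlgebraicGeometry.Frobenioids Literature.AlgebraicGeometry.Frobenioids.IntAffine

namespace AffDil

/-! ## §1 The dilating divisor monoid and the unit-carrying rational functions over `SingleObj Aff⁺(ℤ)` -/

/-- The contraction `z ↦ z/n` of `ℚ_{≥0}` attached to the base arrow `(n, u)` (the translation `u` acts trivially, as
`U` does in [FrdI] Ex. 3.9). [cite: MochizukiEtTh2009, Def 3.6 p.76] -/
def sc (g : IntAffine.G) : DilSwap.M →* DilSwap.M := DilSwap.scale ((expo g : ℕ+) : ℚ≥0)⁻¹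

/-- `sc 1 = id`. [cite: MochizukiEtTh2009, Def 3.6 p.76] -/
theorem sc_one : sc 1 = MonoidHom.id _ := by
  rw [sc, expo_one, PNat.one_coe, Nat.cast_one, inv_one, DilSwap.scale_one]

/-- `sc (g·h) = sc h ∘ sc g` (contractions commute). [cite: MochizukiEtTh2009, Def 3.6 p.76] -/
theorem sc_mul (g h : IntAffine.G) : sc (g * h) = (sc h).comp (sc g) := by
  rw [sc, sc, sc, expo_mul, PNat.mul_coe, Nat.cast_mul, mul_inv, mul_comm, DilSwap.scale_mul]

/-- `Φ₀ = Φ₀^ℝ : (SingleObj Aff⁺(ℤ))ᵒᵖ → 𝔐𝔬𝔫`, `• ↦ ℚ_{≥0}`, the arrow `(n, u)` pulling back by the contraction `z ↦ z/n`.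
[cite: MochizukiEtTh2009, Def 3.6 p.76] -/
def Φfun : (IntAffine.D)ᵒᵖ ⥤ CommMonCat.{0} where
  obj _ := CommMonCat.of DilSwap.M
  map f := CommMonCat.ofHom (sc f.unop)
  map_id A := by
    apply CommMonCat.hom_ext
    rw [CommMonCat.hom_ofHom, CommMonCat.hom_id]
    exact sc_one
  map_comp f g := by
    apply CommMonCat.hom_ext
    rw [CommMonCat.hom_ofHom, CommMonCat.hom_comp, CommMonCat.hom_ofHom, CommMonCat.hom_ofHom]
    change sc (g.unop ≫ f.unop) = _
    rw [SingleObj.comp_as_mul, sc_mul]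

/-- Value of the pull-back of `Φfun`. [cite: MochizukiEtTh2009, Def 3.6 p.76] -/
@[simp] theorem Φfun_map_apply {A B : (IntAffine.D)ᵒᵖ} (f : A ⟶ B) (x : DilSwap.M) :
    (Φfun.map f).hom x = sc f.unop x := rfl

/-- `B₀ = B₀^Λ : • ↦ ℤ × (ℚ_{≥0})^gp` — rational functions carry a free UNIT coordinate `k ∈ ℤ` (acted on trivially by the
base) next to their divisor class. [cite: MochizukiEtTh2009, Def 3.6 p.76] -/
def Bfun : (IntAffine.D)ᵒᵖ ⥤ CommMonCat.{0} where
  obj _ := CommMonCat.of (Multiplicative ℤ × Algebra.GrothendieckGroup DilSwap.M)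
  map f := CommMonCat.ofHom (MonoidHom.prodMap (MonoidHom.id _) (MonGp.map (sc f.unop)))
  map_id A := by
    apply CommMonCat.hom_ext
    rw [CommMonCat.hom_ofHom, CommMonCat.hom_id]
    change MonoidHom.prodMap (MonoidHom.id _) (MonGp.map (sc 1)) = _
    rw [sc_one, MonGp.map_id]
    rfl
  map_comp f g := by
    apply CommMonCat.hom_ext
    rw [CommMonCat.hom_ofHom, CommMonCat.hom_comp, CommMonCat.hom_ofHom, CommMonCat.hom_ofHom]
    change MonoidHom.prodMap (MonoidHom.id _) (MonGp.map (sc (g.unop ≫ f.unop))) = _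
    rw [SingleObj.comp_as_mul, sc_mul, MonGp.map_comp]
    rfl

/-- `Div : B₀ → Φ₀^gp`, the second projection, objectwise. [cite: MochizukiEtTh2009, Def 3.3 p.73] -/
def divSnd (A : (IntAffine.D)ᵒᵖ) : (Bfun.obj A : Type) →* Algebra.GrothendieckGroup (Φfun.obj A) :=
  MonoidHom.snd (Multiplicative ℤ) (Algebra.GrothendieckGroup DilSwap.M)

/-- The trivial [FrdI] category vocabulary on `SingleObj Aff⁺(ℤ)`. [cite: MochizukiEtTh2009, Def 3.6 p.77] -/
def catVocab : FrdICatStub.{0, 0, 0} IntAffine.D where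
  IsDivisorialOn _ := True
  IsRational _ := True
  IsStrictlyRational _ := True

/-! ## §2 Def. 3.3 (iii) / 3.6 (i) data and the tempered Frobenioid -/

/-- Def. 3.3 (iii) data over the affine base. [cite: MochizukiEtTh2009, Def 3.3 p.73] -/
def divisorMonoids : DivisorMonoids.{0, 0, 0} IntAffine.D where
  Φ₀ := Φfun
  B₀ := Bfun
  isUnit_B₀ _ b := by
    change IsUnit (M := Multiplicative ℤ × Algebra.GrothendieckGroup DilSwap.M) b
    exact Group.isUnit _
  div₀ := divSnd
  div₀_natural _ _ := rfl
  F₀ _ := ⊤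
  F₀_map _ _ _ := trivial
  ncsp₀ _ := ⊤
  csp₀ _ := ⊥
  ncsp₀_map _ _ _ := trivial
  csp₀_map _ x hx := by
    rw [Submonoid.mem_bot] at hx ⊢
    rw [hx, map_one]
  existsUnique_ncsp_csp _ x := by
    refine ⟨(⟨x, trivial⟩, ⟨1, Submonoid.mem_bot.mpr rfl⟩), mul_one x, ?_⟩
    rintro ⟨a, c⟩ h
    have hc : c.1 = 1 := Submonoid.mem_bot.mp c.2
    have ha : a.1 = x := by
      have h' : a.1 * c.1 = x := h
      rwa [hc, mul_one] at h'
    exact Prod.ext (Subtype.ext ha) (Subtype.ext hc)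

/-- Def. 3.6 (i) data over the affine base (`Λ = ℚ`, `Φ₀^ℝ = Φ₀`, `B₀^Λ = B₀ = ℤ × (ℚ≥0)^gp`, `Div =` second projection,
`F₀^Λ = B₀^Λ`, `ℝ·Φ₀^cnst =` everything), over the trivial monoid vocabulary. [cite: MochizukiEtTh2009, Def 3.6 p.76] -/
def realified : RealifiedDivisorMonoids (D₀ := IntAffine.D) Toy.monoidVocab where
  toDivisorMonoids := divisorMonoids
  Λ := MonoidType.Q
  ΦR := Φfun
  toR _ := MonoidHom.id _
  toR_natural _ _ := rfl
  isRealification _ := trivial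
  BΛ := Bfun
  isUnit_BΛ _ b := by
    change IsUnit (M := Multiplicative ℤ × Algebra.GrothendieckGroup DilSwap.M) b
    exact Group.isUnit _
  divΛ := divSnd
  divΛ_natural _ _ := rfl
  FΛ _ := ⊤
  FΛ_map _ _ _ := trivial
  cnstR _ := ⊤
  cnstR_map _ _ _ := trivial
  divΛ_mem_cnstR _ _ _ := trivial
  cnstR_root _ _ _ _ := trivial
  cnst_le_cnstR _ _ _ := trivial
  ncspR _ := ⊤
  cspR _ := ⊥
  toR_ncsp _ _ _ := trivial
  toR_csp _ _ hx := hx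

/-- **Def. 3.6 (ii) AS TYPED, the dilating inhabitant over the ADMISSIBLE base**: `D = D₀ = SingleObj Aff⁺(ℤ)` (connected,
totally epimorphic, of FSMFF-type, not a groupoid), `Φ = Φ^{ℝ-log} = ℚ_{≥0}` pulled back by contractions, `Φ^{bs-fld} = ℚ_{≥0}`
`ℚ`-monoprime (REAL), Def. 3.6 (ii)(b) witnessed by the constant `(0, [1]) ∈ B₀^Λ` with divisor `1 − 0 ≠ 0`; vocabulary
clauses `True`. [cite: MochizukiEtTh2009, Def 3.6 p.77] -/
def C : TemperedFrobenioid realified IntAffine.D catVocab where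
  isConnected := IntAffine.isConnected_D
  isTotallyEpimorphic := IntAffine.isTotallyEpimorphic_D
  base := 𝟭 _
  Φ := ⟨fun _ => ⊤, fun _ _ _ => trivial⟩
  isGroupSaturated A := (isGroupSaturated_iff' _).2 fun _ _ _ _ _ _ => trivial
  isPerfFactorial _ := trivial
  isDivisorialOn := trivial
  isMonoprime_bsFld A := DilSwap.isMonoprime_of_eq_top
    (eq_top_iff.2 fun x _ => Submonoid.mem_inf.2 ⟨Submonoid.mem_top x,
      (Subgroup.mem_top (Algebra.GrothendieckGroup.of x) :
        Algebra.GrothendieckGroup.of x ∈ (⊤ : Subgroup (Algebra.GrothendieckGroup DilSwap.M)))⟩)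
  exists_FΛ_div_ne A := by
    refine ⟨(1, Algebra.GrothendieckGroup.of (Multiplicative.ofAdd (1 : ℚ≥0))), trivial,
      Multiplicative.ofAdd (1 : ℚ≥0), trivial, 1, trivial, ?_, ?_⟩
    · intro h
      have h' : (Multiplicative.ofAdd (1 : ℚ≥0) : DilSwap.M) = (1 : DilSwap.M) := h
      have h'' := congrArg Multiplicative.toAdd h'
      simp at h''
    · have h1 : Algebra.GrothendieckGroup.of (1 : DilSwap.M) = 1 := map_one _
      change (Algebra.GrothendieckGroup.of (Multiplicative.ofAdd (1 : ℚ≥0)) : Algebra.GrothendieckGroup DilSwap.M) =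
        Algebra.GrothendieckGroup.of (Multiplicative.ofAdd (1 : ℚ≥0)) / Algebra.GrothendieckGroup.of (1 : DilSwap.M)
      rw [h1, div_one]

/-- The base of `C` is of FSMFF-type (REAL clause of `Cor38Hyp`). [cite: MochizukiEtTh2009, Cor 3.8 p.80] -/
theorem isOfFSMFFType_base : IsOfFSMFFType IntAffine.D := IntAffine.isOfFSMFFType_D

/-- The constant object data: the unique point of the base. [cite: MochizukiEtTh2009, Def 3.6 p.76] -/
abbrev pt : IntAffine.D := SingleObj.star IntAffine.G

/-- The zero object `X₀ = (•, 0)` of the model category of `C`. [cite: MochizukiFrdI2008, Thm. 5.2 p.101] -/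
abbrev X₀ : C.category := ⟨pt, 1⟩

/-- The LINEAR base-dilation `λ₂ = (deg 1, base (2,0), Div 0, unit (0,[0]))` of `X₀` — a linear arrow whose base
`x ↦ 2x` is NOT an isomorphism (test arrow for the swap of brick 2b). [cite: MochizukiFrdI2008, Def. 1.2 (i) p.21] -/
def lam₂ : X₀ ⟶ X₀ where
  degFr := 1
  base := (IntAffine.mk 2 0 : IntAffine.G)
  div := 1
  unit := 1
  rel := by rw [one_pow, map_one, map_one, map_one]

/-- `λ₂` is linear. [cite: MochizukiFrdI2008, Def. 1.2 (i) p.21] -/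
theorem isLinear_lam₂ : C.opsData.IsLinear lam₂ := rfl

/-- `λ₂` is NOT a base-isomorphism (hence not a pre-step): `x ↦ 2x` is not invertible in `Aff⁺(ℤ)`.
[cite: MochizukiFrdI2008, Def. 1.2 (ii) p.21] -/
theorem not_isBaseIso_lam₂ : ¬ C.opsData.IsBaseIso lam₂ := IntAffine.not_isIso_dilation

/-- The degree-`2` base-identity Frobenius arrow `F₂ = (deg 2, base id, Div 0, unit 1)` of `X₀` — the intended image of
`λ₂` under the swap. [cite: MochizukiFrdI2008, Def. 1.2 (iii) p.22] -/
def frob₂ : X₀ ⟶ X₀ where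
  degFr := 2
  base := 𝟙 pt
  div := 1
  unit := 1
  rel := by rw [one_pow, map_one, map_one, map_one]

/-- `F₂` is not linear. [cite: MochizukiFrdI2008, Def. 1.2 (i) p.21] -/
theorem not_isLinear_frob₂ : ¬ C.opsData.IsLinear frob₂ := by
  change (2 : ℕ+) ≠ 1
  decide

end AffDil

end Literature.AnabelianGeometry.EtaleTheta

end
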